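import Literature.AnabelianGeometry.EtaleTheta.BiKummerThm44SubModelConnectedOfGaloisCovering
import Literature.AnabelianGeometry.EtaleTheta.BiKummerThm44SubNHSatDef22
import Literature.AnabelianGeometry.EtaleTheta.BiKummerThm44SubNHSatDef22Conj

/-!
# [EtTh] Theorem 4.4 (i)(ii)(iii) + `N`-th roots over the constructed Def 3.3 (iii) data of the connected coverings,
# WITH T44-L15b AT THE FAITHFUL [FrdII] Def 2.2 (ii) READING — the print-shaped residual {`hNH`, `hIso`} and nothing
# structural (proof-only)

S. Mochizuki, *The étale theta function …*, Publ. RIMS **45** (2009) [MochizukiEtTh2009], §4, Thm 4.4 (i)–(iii) PDF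
p.94, proof p.95 ll.14–16 («cf. [FrdII], Definition 2.2, (ii); [AbsAnab], Lemma 1.3.8»); S. Mochizuki, *The geometry of
Frobenioids II* (2008) [MochizukiFrdII2008], Def 2.2 (ii) p.17, Thm 2.4 (i) p.19.  abc-iut cell, layer L2,
plan/L2/SUBDAG-EtTh-Thm44.md (custodian lineage abc-iut-w5-d179), cone nodes `EtTh:Thm4.4(i)`, `EtTh:Thm4.4(ii)`,
`EtTh:Thm4.4(iii)`, sub-DAG row T44-L15b.  Seat abc-iut-w5-d179 (gen 5).  PROOF-ONLY (0 `def`s, no `Prop` facts, no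
instances); abc-iut-w6-d047's `Thm44Hyp.preservesNHSaturatedBsFld_of_def22Iso` (T44-L15b ⇐ faithful reading + context
isomorphisms, `BiKummerThm44SubNHSatDef22.lean`) and this lineage's `…_ofGaloisActionConnected[_treeVocabWeak]`
(`BiKummerThm44SubModelConnectedOfGaloisCovering.lean`, p439044: `hBinj` DISCHARGED at abc-iut-w6-d058's
`DivisorMonoids.ofGaloisActionConnected`) are CONSUMED BY NAME; nothing landed is edited or restated.

WHAT THIS FILE PROVES.  At the weak (resp. strong) Def 3.6 (i) data `Λ = ℤ` of the connected coverings dominated by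
universal combinatorial coverings, for ANY tempered Frobenioids `tf₁`, `tf₂` over them and abc-iut-L2-t4's genuine
connected base `mkOfConnectedTemperoid` whose `(N, H_⊙^{bs-fld})`-saturation slots READ [FrdII] Def 2.2 (ii) through
Def 2.2 context assignments `ctx_i` (`hNH_i`):

  **[EtTh] Thm 4.4 (i) ∧ (ii) ∧ (iii) ∧ (`N`-th roots) ⇐ {`hIso`}** — the context isomorphisms `Ψ` induces on
  Frobenius-trivial objects ([FrdI] Thm 3.4 (v), [SemiAnbd] Prop 3.2, [AbsAnab] Lem 1.3.8) — and NO structural binder: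
  no `hBinj`, no `hBmon`, no Rmk 3.7.2, no perf-factorial hypothesis, no plan/FACT-LIST fact
  (`thm44_mkOfConnectedTemperoid_ofGaloisActionConnected_treeVocabWeak_of_def22Iso`; strong twin
  `…_ofGaloisActionConnected_of_def22Iso` with the printed perf-factorial slot `hpf_i` as the constructor parameter).

Binder census of the three cone nodes at this data and this reading: {`hNH₁`, `hNH₂` (the READING itself — the
interface datum «Def 2.2 context of an object of `C^{bs-fld}`», census of `BiKummerThm44SubNHSatDef22.lean`), `hIso`}.
HONEST FRAMING: refereed pre-IUT material; every theorem is an implication for data so parametrised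
(`LogDivisorModel` / `GaloisAction` / `CuspLaws` are interface and parameter records); one term of the Def 3.3 (iii)
limit (Rmk 3.3.1); nothing here bears on the disputed [IUTchIII] Cor. 3.12; typed ≠ proved — here PROVED (kernel
compositions).
-/

noncomputable section

namespace Literature.AnabelianGeometry.EtaleTheta

open CategoryTheory Opposite Function Literature.AlgebraicGeometry.Frobenioids Literature.AnabelianGeometry.SemiGraphs

universe u

namespace BiKummerSetting

/-! ### §1 Weak Def 3.6 (i) data of the connected coverings, faithful [FrdII] Def 2.2 (ii) reading -/

section WeakDef22

variable {Z₁ : LogDivisorModel.{u}} {G₁ : Type u} [Group G₁] (GA₁ : Z₁.GaloisAction G₁) (hC₁ : Z₁.CuspLaws)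
  {Z₂ : LogDivisorModel.{u}} {G₂ : Type u} [Group G₂] (GA₂ : Z₂.GaloisAction G₂) (hC₂ : Z₂.CuspLaws)
  {K : Type (u + 1)} [Field K] {K' : Type (u + 1)} [Field K'] {X₁ : SemiGraphs.TemperedArithmeticGroup.{u + 1} K}
  {X₂ : SemiGraphs.TemperedArithmeticGroup.{u + 1} K'}
  {IsRational₁ IsStrictlyRational₁ : ((ConnectedPart (BTemp X₁.Pi))ᵒᵖ ⥤ CommMonCat.{u}) → Prop}
  {IsRational₂ IsStrictlyRational₂ : ((ConnectedPart (BTemp X₂.Pi))ᵒᵖ ⥤ CommMonCat.{u}) → Prop}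
  {tf₁ : TemperedFrobenioid
    (RealifiedDivisorMonoids.ofRlfZWeak (DivisorMonoids.ofGaloisActionConnected GA₁ hC₁)
      (DivisorMonoids.ofGaloisActionConnected_isPerfFactorialCof GA₁ hC₁))
    (ConnectedPart (BTemp X₁.Pi)) (treeCatVocab (ConnectedPart (BTemp X₁.Pi)) IsRational₁ IsStrictlyRational₁)}
  {hZ₁ : tf₁.monoidType = MonoidType.Z} {hP₁ : ∀ A : (ConnectedPart (BTemp X₁.Pi))ᵒᵖ, IsPerfect (tf₁.Φ.carrier A)}
  {NH₁ : Subgroup (Field.absoluteGaloisGroup K) → tf₁.category → ℕ+ → Prop} {A₁ : tf₁.category}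
  {hA₁ : PreFrobenioid.IsFrobeniusTrivial tf₁.toElem A₁} {hA₁' : SemiGraphs.IsGaloisObj A₁.base.obj}
  {tf₂ : TemperedFrobenioid
    (RealifiedDivisorMonoids.ofRlfZWeak (DivisorMonoids.ofGaloisActionConnected GA₂ hC₂)
      (DivisorMonoids.ofGaloisActionConnected_isPerfFactorialCof GA₂ hC₂))
    (ConnectedPart (BTemp X₂.Pi)) (treeCatVocab (ConnectedPart (BTemp X₂.Pi)) IsRational₂ IsStrictlyRational₂)}
  {hZ₂ : tf₂.monoidType = MonoidType.Z} {hP₂ : ∀ B : (ConnectedPart (BTemp X₂.Pi))ᵒᵖ, IsPerfect (tf₂.Φ.carrier B)}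
  {NH₂ : Subgroup (Field.absoluteGaloisGroup K') → tf₂.category → ℕ+ → Prop} {A₂ : tf₂.category}
  {hA₂ : PreFrobenioid.IsFrobeniusTrivial tf₂.toElem A₂} {hA₂' : SemiGraphs.IsGaloisObj A₂.base.obj}

/-- **T44-L15b at the faithful [FrdII] Def 2.2 (ii) reading over the weak data of the connected coverings ⇐ `hIso`**
(abc-iut-w6-d047's `preservesNHSaturatedBsFld_of_def22Iso`, instantiated). [cite: MochizukiEtTh2009, Thm 4.4 (iii) p.95] -/
theorem Thm44Hyp.preservesNHSaturatedBsFld_ofGaloisActionConnected_treeVocabWeak_of_def22Iso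
    (h : Thm44Hyp (mkOfConnectedTemperoid X₁ tf₁ hZ₁ hP₁ NH₁ A₁ hA₁ hA₁')
      (mkOfConnectedTemperoid X₂ tf₂ hZ₂ hP₂ NH₂ A₂ hA₂ hA₂'))
    (ctx₁ : tf₁.category → PadicKummer.Def22Context) (ctx₂ : tf₂.category → PadicKummer.Def22Context)
    (hNH₁ : ∀ (A : tf₁.category) (N : ℕ+),
      NH₁ (mkOfConnectedTemperoid X₁ tf₁ hZ₁ hP₁ NH₁ A₁ hA₁ hA₁').HodotBsFld A N ↔
        PadicKummer.IsNHSaturated (ctx₁ A) N)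
    (hNH₂ : ∀ (B : tf₂.category) (N : ℕ+),
      NH₂ (mkOfConnectedTemperoid X₂ tf₂ hZ₂ hP₂ NH₂ A₂ hA₂ hA₂').HodotBsFld B N ↔
        PadicKummer.IsNHSaturated (ctx₂ B) N)
    (hIso : ∀ (A'' : tf₁.category) (B'' : tf₂.category), PreFrobenioid.IsFrobeniusTrivial tf₁.toElem A'' →
      (h.Ψ.functor.obj A'' ≅ B'') → Nonempty (PadicKummer.Def22Context.Iso (ctx₁ A'') (ctx₂ B''))) :
    Thm44Hyp.PreservesNHSaturatedBsFld (V := treeMonoidVocabWeak.{u}) h :=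
  h.preservesNHSaturatedBsFld_of_def22Iso ctx₁ ctx₂ hNH₁ hNH₂ hIso

/-- **[EtTh] Theorem 4.4 (i) ∧ (ii) ∧ (iii) ∧ (`N`-th roots) at the genuine connected base `B^temp(Π^tp_X)⁰` over the
WEAK Def 3.6 (i) data `Λ = ℤ` of the connected coverings, T44-L15b AT THE FAITHFUL [FrdII] Def 2.2 (ii) READING
(`hNH₁`, `hNH₂`) ⇐ {`hIso`} — NO structural binder** (`ψ = psiModel hF₁ hF₂ h3`, any proofs, e.g. this lineage's
unconditional `isFrobenioid_ofGaloisActionConnected_treeVocabWeak` / `preservesFrobeniusStructure_…_treeVocabWeak`):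
p439044's `thm44_mkOfConnectedTemperoid_ofGaloisActionConnected_treeVocabWeak` with T44-L15b supplied by the faithful
reading.  Print's inputs for `hIso`: [FrdI] Thm 3.4 (v), [SemiAnbd] Prop 3.2, [AbsAnab] Lem 1.3.8.
[cite: MochizukiEtTh2009, Thm 4.4 p.94] -/
theorem Thm44Hyp.thm44_mkOfConnectedTemperoid_ofGaloisActionConnected_treeVocabWeak_of_def22Iso
    (h : Thm44Hyp (mkOfConnectedTemperoid X₁ tf₁ hZ₁ hP₁ NH₁ A₁ hA₁ hA₁')
      (mkOfConnectedTemperoid X₂ tf₂ hZ₂ hP₂ NH₂ A₂ hA₂ hA₂'))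
    (hF₁ : PreFrobenioid.IsFrobenioid tf₁.toElem) (hF₂ : PreFrobenioid.IsFrobenioid tf₂.toElem)
    (h3 : h.PreservesFrobeniusStructure)
    (ctx₁ : tf₁.category → PadicKummer.Def22Context) (ctx₂ : tf₂.category → PadicKummer.Def22Context)
    (hNH₁ : ∀ (A : tf₁.category) (N : ℕ+),
      NH₁ (mkOfConnectedTemperoid X₁ tf₁ hZ₁ hP₁ NH₁ A₁ hA₁ hA₁').HodotBsFld A N ↔
        PadicKummer.IsNHSaturated (ctx₁ A) N)
    (hNH₂ : ∀ (B : tf₂.category) (N : ℕ+),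
      NH₂ (mkOfConnectedTemperoid X₂ tf₂ hZ₂ hP₂ NH₂ A₂ hA₂ hA₂').HodotBsFld B N ↔
        PadicKummer.IsNHSaturated (ctx₂ B) N)
    (hIso : ∀ (A'' : tf₁.category) (B'' : tf₂.category), PreFrobenioid.IsFrobeniusTrivial tf₁.toElem A'' →
      (h.Ψ.functor.obj A'' ≅ B'') → Nonempty (PadicKummer.Def22Context.Iso (ctx₁ A'') (ctx₂ B''))) :
    Thm44_i (V := treeMonoidVocabWeak.{u}) h ∧ Thm44_ii h (h.psiModel hF₁ hF₂ h3) ∧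
      Thm44_iii h (h.psiModel hF₁ hF₂ h3) ∧
      h.PreservesNthRoots (h.psiModel hF₁ hF₂ h3) (fun φ f => tf₁.pullFracModel φ f)
        (fun φ f => tf₂.pullFracModel φ f) :=
  h.thm44_mkOfConnectedTemperoid_ofGaloisActionConnected_treeVocabWeak GA₁ hC₁ GA₂ hC₂ hF₁ hF₂ h3
    (h.preservesNHSaturatedBsFld_ofGaloisActionConnected_treeVocabWeak_of_def22Iso GA₁ hC₁ GA₂ hC₂ ctx₁ ctx₂ hNH₁
      hNH₂ hIso)

/-- **The same with every ψ-slot proof supplied by the tree** — literally ⇐ {`hNH₁`, `hNH₂`, `hIso`}.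
[cite: MochizukiEtTh2009, Thm 4.4 p.94] -/
theorem Thm44Hyp.thm44_mkOfConnectedTemperoid_ofGaloisActionConnected_treeVocabWeak_of_def22Iso'
    (h : Thm44Hyp (mkOfConnectedTemperoid X₁ tf₁ hZ₁ hP₁ NH₁ A₁ hA₁ hA₁')
      (mkOfConnectedTemperoid X₂ tf₂ hZ₂ hP₂ NH₂ A₂ hA₂ hA₂'))
    (ctx₁ : tf₁.category → PadicKummer.Def22Context) (ctx₂ : tf₂.category → PadicKummer.Def22Context)
    (hNH₁ : ∀ (A : tf₁.category) (N : ℕ+),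
      NH₁ (mkOfConnectedTemperoid X₁ tf₁ hZ₁ hP₁ NH₁ A₁ hA₁ hA₁').HodotBsFld A N ↔
        PadicKummer.IsNHSaturated (ctx₁ A) N)
    (hNH₂ : ∀ (B : tf₂.category) (N : ℕ+),
      NH₂ (mkOfConnectedTemperoid X₂ tf₂ hZ₂ hP₂ NH₂ A₂ hA₂ hA₂').HodotBsFld B N ↔
        PadicKummer.IsNHSaturated (ctx₂ B) N)
    (hIso : ∀ (A'' : tf₁.category) (B'' : tf₂.category), PreFrobenioid.IsFrobeniusTrivial tf₁.toElem A'' →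
      (h.Ψ.functor.obj A'' ≅ B'') → Nonempty (PadicKummer.Def22Context.Iso (ctx₁ A'') (ctx₂ B''))) :
    Thm44_i (V := treeMonoidVocabWeak.{u}) h ∧
      Thm44_ii h (h.psiModel (isFrobenioid_ofGaloisActionConnected_treeVocabWeak GA₁ hC₁)
        (isFrobenioid_ofGaloisActionConnected_treeVocabWeak GA₂ hC₂)
        (h.preservesFrobeniusStructure_mkOfConnectedTemperoid_ofGaloisActionConnected_treeVocabWeak GA₁ hC₁ GA₂ hC₂)) ∧
      Thm44_iii h (h.psiModel (isFrobenioid_ofGaloisActionConnected_treeVocabWeak GA₁ hC₁)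
        (isFrobenioid_ofGaloisActionConnected_treeVocabWeak GA₂ hC₂)
        (h.preservesFrobeniusStructure_mkOfConnectedTemperoid_ofGaloisActionConnected_treeVocabWeak GA₁ hC₁ GA₂ hC₂)) ∧
      h.PreservesNthRoots (h.psiModel (isFrobenioid_ofGaloisActionConnected_treeVocabWeak GA₁ hC₁)
        (isFrobenioid_ofGaloisActionConnected_treeVocabWeak GA₂ hC₂)
        (h.preservesFrobeniusStructure_mkOfConnectedTemperoid_ofGaloisActionConnected_treeVocabWeak GA₁ hC₁ GA₂ hC₂))
        (fun φ f => tf₁.pullFracModel φ f) (fun φ f => tf₂.pullFracModel φ f) :=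
  h.thm44_mkOfConnectedTemperoid_ofGaloisActionConnected_treeVocabWeak_of_def22Iso GA₁ hC₁ GA₂ hC₂ _ _ _ ctx₁ ctx₂
    hNH₁ hNH₂ hIso

end WeakDef22

/-! ### §2 Strong Def 3.6 (i) data `ofRlfZ … hpf` of the connected coverings, faithful [FrdII] Def 2.2 (ii) reading -/

section StrongDef22

variable {Z₁ : LogDivisorModel.{u}} {G₁ : Type u} [Group G₁] (GA₁ : Z₁.GaloisAction G₁) (hC₁ : Z₁.CuspLaws)
  (hpf₁ : ∀ Y : ((LogDivisorModel.GaloisAction.isConnectedGSet (G := G₁)).FullSubcategory)ᵒᵖ,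
    IsPerfFactorial ((DivisorMonoids.ofGaloisActionConnected GA₁ hC₁).Φ₀.obj Y))
  {Z₂ : LogDivisorModel.{u}} {G₂ : Type u} [Group G₂] (GA₂ : Z₂.GaloisAction G₂) (hC₂ : Z₂.CuspLaws)
  (hpf₂ : ∀ Y : ((LogDivisorModel.GaloisAction.isConnectedGSet (G := G₂)).FullSubcategory)ᵒᵖ,
    IsPerfFactorial ((DivisorMonoids.ofGaloisActionConnected GA₂ hC₂).Φ₀.obj Y))
  {K : Type (u + 1)} [Field K] {K' : Type (u + 1)} [Field K'] {X₁ : SemiGraphs.TemperedArithmeticGroup.{u + 1} K}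
  {X₂ : SemiGraphs.TemperedArithmeticGroup.{u + 1} K'}
  {IsRational₁ IsStrictlyRational₁ : ((ConnectedPart (BTemp X₁.Pi))ᵒᵖ ⥤ CommMonCat.{u}) → Prop}
  {IsRational₂ IsStrictlyRational₂ : ((ConnectedPart (BTemp X₂.Pi))ᵒᵖ ⥤ CommMonCat.{u}) → Prop}
  {tf₁ : TemperedFrobenioid (RealifiedDivisorMonoids.ofRlfZ (DivisorMonoids.ofGaloisActionConnected GA₁ hC₁) hpf₁)
    (ConnectedPart (BTemp X₁.Pi)) (treeCatVocab (ConnectedPart (BTemp X₁.Pi)) IsRational₁ IsStrictlyRational₁)}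
  {hZ₁ : tf₁.monoidType = MonoidType.Z} {hP₁ : ∀ A : (ConnectedPart (BTemp X₁.Pi))ᵒᵖ, IsPerfect (tf₁.Φ.carrier A)}
  {NH₁ : Subgroup (Field.absoluteGaloisGroup K) → tf₁.category → ℕ+ → Prop} {A₁ : tf₁.category}
  {hA₁ : PreFrobenioid.IsFrobeniusTrivial tf₁.toElem A₁} {hA₁' : SemiGraphs.IsGaloisObj A₁.base.obj}
  {tf₂ : TemperedFrobenioid (RealifiedDivisorMonoids.ofRlfZ (DivisorMonoids.ofGaloisActionConnected GA₂ hC₂) hpf₂)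
    (ConnectedPart (BTemp X₂.Pi)) (treeCatVocab (ConnectedPart (BTemp X₂.Pi)) IsRational₂ IsStrictlyRational₂)}
  {hZ₂ : tf₂.monoidType = MonoidType.Z} {hP₂ : ∀ B : (ConnectedPart (BTemp X₂.Pi))ᵒᵖ, IsPerfect (tf₂.Φ.carrier B)}
  {NH₂ : Subgroup (Field.absoluteGaloisGroup K') → tf₂.category → ℕ+ → Prop} {A₂ : tf₂.category}
  {hA₂ : PreFrobenioid.IsFrobeniusTrivial tf₂.toElem A₂} {hA₂' : SemiGraphs.IsGaloisObj A₂.base.obj}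

/-- **[EtTh] Theorem 4.4 (i) ∧ (ii) ∧ (iii) ∧ (`N`-th roots) at the genuine connected base over the STRONG Def 3.6 (i)
data `Λ = ℤ` of the connected coverings, T44-L15b AT THE FAITHFUL [FrdII] Def 2.2 (ii) READING ⇐ {`hIso`}** beyond
the reading `hNH_i` and the constructor parameters `hpf_i` (p439044's `thm44_mkOfConnectedTemperoid_ofGaloisActionConnected`
with abc-iut-w6-d047's `preservesNHSaturatedBsFld_mkOfConnectedTemperoid_of_def22Iso`). [cite: MochizukiEtTh2009, Thm 4.4 p.94] -/
theorem Thm44Hyp.thm44_mkOfConnectedTemperoid_ofGaloisActionConnected_of_def22Iso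
    (h : Thm44Hyp (mkOfConnectedTemperoid X₁ tf₁ hZ₁ hP₁ NH₁ A₁ hA₁ hA₁')
      (mkOfConnectedTemperoid X₂ tf₂ hZ₂ hP₂ NH₂ A₂ hA₂ hA₂'))
    (hF₁ : PreFrobenioid.IsFrobenioid tf₁.toElem) (hF₂ : PreFrobenioid.IsFrobenioid tf₂.toElem)
    (h3 : h.PreservesFrobeniusStructure)
    (ctx₁ : tf₁.category → PadicKummer.Def22Context) (ctx₂ : tf₂.category → PadicKummer.Def22Context)
    (hNH₁ : ∀ (A : tf₁.category) (N : ℕ+),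
      NH₁ (mkOfConnectedTemperoid X₁ tf₁ hZ₁ hP₁ NH₁ A₁ hA₁ hA₁').HodotBsFld A N ↔
        PadicKummer.IsNHSaturated (ctx₁ A) N)
    (hNH₂ : ∀ (B : tf₂.category) (N : ℕ+),
      NH₂ (mkOfConnectedTemperoid X₂ tf₂ hZ₂ hP₂ NH₂ A₂ hA₂ hA₂').HodotBsFld B N ↔
        PadicKummer.IsNHSaturated (ctx₂ B) N)
    (hIso : ∀ (A'' : tf₁.category) (B'' : tf₂.category), PreFrobenioid.IsFrobeniusTrivial tf₁.toElem A'' →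
      (h.Ψ.functor.obj A'' ≅ B'') → Nonempty (PadicKummer.Def22Context.Iso (ctx₁ A'') (ctx₂ B''))) :
    Thm44_i h ∧ Thm44_ii h (h.psiModel hF₁ hF₂ h3) ∧ Thm44_iii h (h.psiModel hF₁ hF₂ h3) ∧
      h.PreservesNthRoots (h.psiModel hF₁ hF₂ h3) (fun φ f => tf₁.pullFracModel φ f)
        (fun φ f => tf₂.pullFracModel φ f) :=
  h.thm44_mkOfConnectedTemperoid_ofGaloisActionConnected GA₁ hC₁ hpf₁ GA₂ hC₂ hpf₂ hF₁ hF₂ h3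
    (h.preservesNHSaturatedBsFld_mkOfConnectedTemperoid_of_def22Iso ctx₁ ctx₂ hNH₁ hNH₂ hIso)

/-- **The same with every ψ-slot proof supplied by the tree** — ⇐ {`hNH₁`, `hNH₂`, `hIso`} beyond `hpf₁` / `hpf₂`.
[cite: MochizukiEtTh2009, Thm 4.4 p.94] -/
theorem Thm44Hyp.thm44_mkOfConnectedTemperoid_ofGaloisActionConnected_of_def22Iso'
    (h : Thm44Hyp (mkOfConnectedTemperoid X₁ tf₁ hZ₁ hP₁ NH₁ A₁ hA₁ hA₁')
      (mkOfConnectedTemperoid X₂ tf₂ hZ₂ hP₂ NH₂ A₂ hA₂ hA₂'))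
    (ctx₁ : tf₁.category → PadicKummer.Def22Context) (ctx₂ : tf₂.category → PadicKummer.Def22Context)
    (hNH₁ : ∀ (A : tf₁.category) (N : ℕ+),
      NH₁ (mkOfConnectedTemperoid X₁ tf₁ hZ₁ hP₁ NH₁ A₁ hA₁ hA₁').HodotBsFld A N ↔
        PadicKummer.IsNHSaturated (ctx₁ A) N)
    (hNH₂ : ∀ (B : tf₂.category) (N : ℕ+),
      NH₂ (mkOfConnectedTemperoid X₂ tf₂ hZ₂ hP₂ NH₂ A₂ hA₂ hA₂').HodotBsFld B N ↔
        PadicKummer.IsNHSaturated (ctx₂ B) N)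
    (hIso : ∀ (A'' : tf₁.category) (B'' : tf₂.category), PreFrobenioid.IsFrobeniusTrivial tf₁.toElem A'' →
      (h.Ψ.functor.obj A'' ≅ B'') → Nonempty (PadicKummer.Def22Context.Iso (ctx₁ A'') (ctx₂ B''))) :
    Thm44_i h ∧
      Thm44_ii h (h.psiModel (isFrobenioid_ofGaloisActionConnected GA₁ hC₁ hpf₁)
        (isFrobenioid_ofGaloisActionConnected GA₂ hC₂ hpf₂)
        (h.preservesFrobeniusStructure_mkOfConnectedTemperoid_ofGaloisActionConnected GA₁ hC₁ hpf₁ GA₂ hC₂ hpf₂)) ∧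
      Thm44_iii h (h.psiModel (isFrobenioid_ofGaloisActionConnected GA₁ hC₁ hpf₁)
        (isFrobenioid_ofGaloisActionConnected GA₂ hC₂ hpf₂)
        (h.preservesFrobeniusStructure_mkOfConnectedTemperoid_ofGaloisActionConnected GA₁ hC₁ hpf₁ GA₂ hC₂ hpf₂)) ∧
      h.PreservesNthRoots (h.psiModel (isFrobenioid_ofGaloisActionConnected GA₁ hC₁ hpf₁)
        (isFrobenioid_ofGaloisActionConnected GA₂ hC₂ hpf₂)
        (h.preservesFrobeniusStructure_mkOfConnectedTemperoid_ofGaloisActionConnected GA₁ hC₁ hpf₁ GA₂ hC₂ hpf₂))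
        (fun φ f => tf₁.pullFracModel φ f) (fun φ f => tf₂.pullFracModel φ f) :=
  h.thm44_mkOfConnectedTemperoid_ofGaloisActionConnected_of_def22Iso GA₁ hC₁ hpf₁ GA₂ hC₂ hpf₂ _ _ _ ctx₁ ctx₂ hNH₁
    hNH₂ hIso

end StrongDef22

/-! ## APPENDIX (v2, append-only): the context isomorphisms UP TO INNER AUTOMORPHISM (abc-iut-w6-d047's relaxation,
`BiKummerThm44SubNHSatDef22Conj.lean`, p445405 — [FrdII] Def 2.2 (i) «outer homomorphism») -/

section WeakDef22Conj

variable {Z₁ : LogDivisorModel.{u}} {G₁ : Type u} [Group G₁] (GA₁ : Z₁.GaloisAction G₁) (hC₁ : Z₁.CuspLaws)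
  {Z₂ : LogDivisorModel.{u}} {G₂ : Type u} [Group G₂] (GA₂ : Z₂.GaloisAction G₂) (hC₂ : Z₂.CuspLaws)
  {K : Type (u + 1)} [Field K] {K' : Type (u + 1)} [Field K'] {X₁ : SemiGraphs.TemperedArithmeticGroup.{u + 1} K}
  {X₂ : SemiGraphs.TemperedArithmeticGroup.{u + 1} K'}
  {IsRational₁ IsStrictlyRational₁ : ((ConnectedPart (BTemp X₁.Pi))ᵒᵖ ⥤ CommMonCat.{u}) → Prop}
  {IsRational₂ IsStrictlyRational₂ : ((ConnectedPart (BTemp X₂.Pi))ᵒᵖ ⥤ CommMonCat.{u}) → Prop}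
  {tf₁ : TemperedFrobenioid
    (RealifiedDivisorMonoids.ofRlfZWeak (DivisorMonoids.ofGaloisActionConnected GA₁ hC₁)
      (DivisorMonoids.ofGaloisActionConnected_isPerfFactorialCof GA₁ hC₁))
    (ConnectedPart (BTemp X₁.Pi)) (treeCatVocab (ConnectedPart (BTemp X₁.Pi)) IsRational₁ IsStrictlyRational₁)}
  {hZ₁ : tf₁.monoidType = MonoidType.Z} {hP₁ : ∀ A : (ConnectedPart (BTemp X₁.Pi))ᵒᵖ, IsPerfect (tf₁.Φ.carrier A)}
  {NH₁ : Subgroup (Field.absoluteGaloisGroup K) → tf₁.category → ℕ+ → Prop} {A₁ : tf₁.category}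
  {hA₁ : PreFrobenioid.IsFrobeniusTrivial tf₁.toElem A₁} {hA₁' : SemiGraphs.IsGaloisObj A₁.base.obj}
  {tf₂ : TemperedFrobenioid
    (RealifiedDivisorMonoids.ofRlfZWeak (DivisorMonoids.ofGaloisActionConnected GA₂ hC₂)
      (DivisorMonoids.ofGaloisActionConnected_isPerfFactorialCof GA₂ hC₂))
    (ConnectedPart (BTemp X₂.Pi)) (treeCatVocab (ConnectedPart (BTemp X₂.Pi)) IsRational₂ IsStrictlyRational₂)}
  {hZ₂ : tf₂.monoidType = MonoidType.Z} {hP₂ : ∀ B : (ConnectedPart (BTemp X₂.Pi))ᵒᵖ, IsPerfect (tf₂.Φ.carrier B)}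
  {NH₂ : Subgroup (Field.absoluteGaloisGroup K') → tf₂.category → ℕ+ → Prop} {A₂ : tf₂.category}
  {hA₂ : PreFrobenioid.IsFrobeniusTrivial tf₂.toElem A₂} {hA₂' : SemiGraphs.IsGaloisObj A₂.base.obj}

/-- **[EtTh] Thm 4.4 (i) ∧ (ii) ∧ (iii) ∧ (`N`-th roots) over the WEAK connected-model data at the faithful [FrdII] Def
2.2 (ii) reading, context isomorphisms UP TO INNER AUTOMORPHISM ⇐ {`hIsoConj`}** (beyond the reading `hNH_i`).
[cite: MochizukiEtTh2009, Thm 4.4 p.94] -/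
theorem Thm44Hyp.thm44_mkOfConnectedTemperoid_ofGaloisActionConnected_treeVocabWeak_of_def22IsoConj
    (h : Thm44Hyp (mkOfConnectedTemperoid X₁ tf₁ hZ₁ hP₁ NH₁ A₁ hA₁ hA₁')
      (mkOfConnectedTemperoid X₂ tf₂ hZ₂ hP₂ NH₂ A₂ hA₂ hA₂'))
    (hF₁ : PreFrobenioid.IsFrobenioid tf₁.toElem) (hF₂ : PreFrobenioid.IsFrobenioid tf₂.toElem)
    (h3 : h.PreservesFrobeniusStructure)
    (ctx₁ : tf₁.category → PadicKummer.Def22Context) (ctx₂ : tf₂.category → PadicKummer.Def22Context)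
    (hNH₁ : ∀ (A : tf₁.category) (N : ℕ+),
      NH₁ (mkOfConnectedTemperoid X₁ tf₁ hZ₁ hP₁ NH₁ A₁ hA₁ hA₁').HodotBsFld A N ↔
        PadicKummer.IsNHSaturated (ctx₁ A) N)
    (hNH₂ : ∀ (B : tf₂.category) (N : ℕ+),
      NH₂ (mkOfConnectedTemperoid X₂ tf₂ hZ₂ hP₂ NH₂ A₂ hA₂ hA₂').HodotBsFld B N ↔
        PadicKummer.IsNHSaturated (ctx₂ B) N)
    (hIsoConj : ∀ (A'' : tf₁.category) (B'' : tf₂.category), PreFrobenioid.IsFrobeniusTrivial tf₁.toElem A'' →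
      (h.Ψ.functor.obj A'' ≅ B'') → ∃ (g₁ : (ctx₁ A'').G) (g₂ : (ctx₂ B'').G),
        Nonempty (PadicKummer.Def22Context.Iso ((ctx₁ A'').conjOuter g₁) ((ctx₂ B'').conjOuter g₂))) :
    Thm44_i (V := treeMonoidVocabWeak.{u}) h ∧ Thm44_ii h (h.psiModel hF₁ hF₂ h3) ∧
      Thm44_iii h (h.psiModel hF₁ hF₂ h3) ∧
      h.PreservesNthRoots (h.psiModel hF₁ hF₂ h3) (fun φ f => tf₁.pullFracModel φ f)
        (fun φ f => tf₂.pullFracModel φ f) :=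
  h.thm44_mkOfConnectedTemperoid_ofGaloisActionConnected_treeVocabWeak GA₁ hC₁ GA₂ hC₂ hF₁ hF₂ h3
    (h.preservesNHSaturatedBsFld_of_def22Iso_conjOuter ctx₁ ctx₂ hNH₁ hNH₂ hIsoConj)

end WeakDef22Conj

end BiKummerSetting

end Literature.AnabelianGeometry.EtaleTheta

end
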